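import Summits.Ventures.Crystal3D.Theorems.StickyWulffConstantNoReconstructionGainOffRegistry
import Summits.Ventures.Crystal3D.Theorems.StickyWulffConstantNoReconstructionGainCubeCap
import HarnessLib

/-!
# Zoned films, local part: per-ball no-gain lemmas along an arbitrary axis

HONEST FRAMING. Part of the venture `Summits/Ventures/Crystal3D` (cell `crystal3d-full`), helper
`--supports` the crux `NoReconstructionGain` (stmt-Ventures-19144, route
`route-Ventures-StickyWulffConstant`), line `adhesion`.  The per-ball ingredients of the zoned-film
rung `zonedFilm_adhesion` (`…ZonedFilm.lean`):

* `card_negCone_le_three_axis` — at most three pairwise-`60°`-separated unit vectors in the lower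
  `35°` cone `⟪u, e⟫ ≤ −t` (`t² > 5/8`) about ANY unit axis `e` (transport of
  `card_negCone_le_three` along an orthonormal frame);
* `partners_unitVectors` — the partners of a ball of a unit packing read as unit vectors;
* `steepFlat_noGainPotential` — (T2) at a film ball whose weight-two partners (substrate, Φ-below)
  are steep from below along an axis and whose Φ-level partners are flat (cone + band lemmas);
* `antipodal_noGainPotential_of_above` — (T2) at a film ball whose partners, except film partners
  known to be Φ-above, lie on `≤ 6` lines through it (the antipodal-slot argument of
  `registry_noGainPotential` / `antipodal_noGainPotential` with an exempt set);
* `zoneLex_lt_iff`, `zoneLex_eq_iff` — order of the lexicographic potential `Z·M + r`, `0 ≤ r < M`.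

WHAT THIS IS NOT: any statement about a class of films (see `…ZonedFilm.lean`); rung F-C1 not
moved.
-/

noncomputable section

namespace Summit.Ventures.Crystal3D.Theorems

open Summit.Ventures.Crystal3D Finset
open Literature.MathematicalPhysics.StatisticalMechanics (fccStacking orderedContacts contactDeficiency)
open Literature.Geometry.DiscreteGeometry (exists_orthonormalBasis_third_eq_unit)
open scoped InnerProductSpace

/-! ### Local counts along an arbitrary axis -/

/-- **At most three in the lower `35°` cone about any axis.**  For a unit vector `e` and
`t ≥ 0`, `t² > 5/8`: a finite set of unit vectors with `⟪u, e⟫ ≤ −t` and pairwise inner products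
`≤ 1/2` has at most three elements (transport of `card_negCone_le_three`). -/
theorem card_negCone_le_three_axis (e : EuclideanSpace ℝ (Fin 3)) (he : ‖e‖ = 1) (t : ℝ)
    (ht0 : 0 ≤ t) (ht : 5 / 8 < t ^ 2) {F : Finset (EuclideanSpace ℝ (Fin 3))}
    (hn : ∀ u ∈ F, ‖u‖ = 1) (hz : ∀ u ∈ F, ⟪u, e⟫_ℝ ≤ -t)
    (hsep : ∀ u ∈ F, ∀ w ∈ F, u ≠ w → ⟪u, w⟫_ℝ ≤ 1 / 2) : F.card ≤ 3 := by
  classical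
  obtain ⟨b, hb⟩ := exists_orthonormalBasis_third_eq_unit he
  have hinj : Set.InjOn (fun u => (b.repr u : EuclideanSpace ℝ (Fin 3))) ↑F :=
    fun u _ w _ h => b.repr.injective h
  rw [← Finset.card_image_of_injOn hinj]
  refine card_negCone_le_three t ht0 ht ?_ ?_ ?_
  · intro u hu
    obtain ⟨w, hw, rfl⟩ := Finset.mem_image.1 hu
    rw [LinearIsometryEquiv.norm_map]; exact hn w hw
  · intro u hu
    obtain ⟨w, hw, rfl⟩ := Finset.mem_image.1 hu
    rw [show (b.repr w : EuclideanSpace ℝ (Fin 3)) 2 = ⟪b 2, w⟫_ℝ from b.repr_apply_apply w 2, hb,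
      real_inner_comm]
    exact hz w hw
  · intro u hu w hw huw
    obtain ⟨u', hu', rfl⟩ := Finset.mem_image.1 hu
    obtain ⟨w', hw', rfl⟩ := Finset.mem_image.1 hw
    rw [LinearIsometryEquiv.inner_map_map]
    exact hsep u' hu' w' hw' fun h => huw (by rw [h])

/-- The partners of a ball `q` of a unit packing, read as unit vectors `x − q`: the map is
injective, the images are unit vectors, pairwise with inner product `≤ 1/2`. -/
theorem partners_unitVectors (X : Finset (EuclideanSpace ℝ (Fin 3)))
    (hX : ∀ p ∈ X, ∀ q ∈ X, p ≠ q → 1 ≤ dist p q) (q : EuclideanSpace ℝ (Fin 3))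
    (S : Finset (EuclideanSpace ℝ (Fin 3))) (hS : ∀ x ∈ S, x ∈ X ∧ dist q x = 1) :
    (S.image fun x => x - q).card = S.card ∧
      (∀ u ∈ S.image (fun x => x - q), ‖u‖ = 1) ∧
      (∀ u ∈ S.image (fun x => x - q), ∀ w ∈ S.image (fun x => x - q), u ≠ w →
        ⟪u, w⟫_ℝ ≤ 1 / 2) := by
  classical
  refine ⟨card_image_of_injOn fun x _ y _ hxy => sub_left_injective hxy, ?_, ?_⟩
  · intro u hu
    obtain ⟨x, hx, rfl⟩ := mem_image.1 hu
    rw [← dist_eq_norm, dist_comm]; exact (hS x hx).2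
  · intro u hu w hw huw
    obtain ⟨x, hx, rfl⟩ := mem_image.1 hu
    obtain ⟨y, hy, rfl⟩ := mem_image.1 hw
    have hux : ‖x - q‖ = 1 := by rw [← dist_eq_norm, dist_comm]; exact (hS x hx).2
    have huy : ‖y - q‖ = 1 := by rw [← dist_eq_norm, dist_comm]; exact (hS y hy).2
    refine inner_le_half_of_one_le_dist hux huy ?_
    rw [dist_eq_norm, sub_sub_sub_cancel_right, ← dist_eq_norm]
    exact hX x (hS x hx).1 y (hS y hy).1 fun hxy => huw (by rw [hxy])

/-! ### The per-ball lemmas -/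

/-- **(T2) at a steep-or-flat ball along an axis `e`.**  `X` a unit packing, `P ⊆ X`, `q` a film
ball, `Φ` an integer potential.  If every substrate partner and every Φ-below film partner `x` of
`q` is steep from below along `e` (`⟪x − q, e⟫ ≤ −√(2/3)`) and every Φ-level film partner is flat
(`|⟪x − q, e⟫| ≤ 1/5`), then `#below + #plug ≤ (12 − deg q) + #above` at `q`
(cone lemma: `≤ 3` weight-two partners; band lemma: `≤ 6` level ones). -/
theorem steepFlat_noGainPotential (X P : Finset (EuclideanSpace ℝ (Fin 3)))
    (hX : ∀ p ∈ X, ∀ q ∈ X, p ≠ q → 1 ≤ dist p q) (hPX : P ⊆ X)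
    (q : EuclideanSpace ℝ (Fin 3)) (Φ : EuclideanSpace ℝ (Fin 3) → ℤ)
    (e : EuclideanSpace ℝ (Fin 3)) (he : ‖e‖ = 1)
    (h2 : ∀ x ∈ X, dist q x = 1 → (x ∈ P ∨ (x ∈ X \ P ∧ Φ x < Φ q)) →
      ⟪x - q, e⟫_ℝ ≤ -Real.sqrt (2 / 3))
    (h1 : ∀ x ∈ X \ P, dist q x = 1 → Φ x = Φ q → |⟪x - q, e⟫_ℝ| ≤ 1 / 5) :
    (((X \ P).filter fun x => dist q x = 1 ∧ Φ x < Φ q).card : ℤ)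
        + ((P.filter fun p => dist q p = 1).card : ℤ)
      ≤ (12 - ((X.filter fun x => dist q x = 1).card : ℤ))
        + (((X \ P).filter fun x => dist q x = 1 ∧ Φ q < Φ x).card : ℤ) := by
  classical
  rw [noGainPotential_iff X P hPX Φ q]
  set h : ℝ := Real.sqrt (2 / 3) with hhdef
  have hh0 : 0 ≤ h := Real.sqrt_nonneg _
  have hh2 : h ^ 2 = 2 / 3 := by rw [hhdef, Real.sq_sqrt]; norm_num
  have hh58 : (5 : ℝ) / 8 < h ^ 2 := by rw [hh2]; norm_num
  -- the weight-two partners: substrate and Φ-below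
  set A := (P.filter fun p => dist q p = 1) ∪ ((X \ P).filter fun x => dist q x = 1 ∧ Φ x < Φ q)
    with hA
  have hPQ : Disjoint P (X \ P) := disjoint_sdiff
  have hAcard : A.card = (P.filter fun p => dist q p = 1).card +
      ((X \ P).filter fun x => dist q x = 1 ∧ Φ x < Φ q).card := by
    rw [hA, card_union_of_disjoint]
    exact disjoint_filter_filter hPQ
  have hAX : ∀ y ∈ A, y ∈ X ∧ dist q y = 1 := by
    intro y hy
    rw [hA, mem_union, mem_filter, mem_filter] at hy
    rcases hy with ⟨hyP, hd⟩ | ⟨hyQ, hd, _⟩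
    · exact ⟨hPX hyP, hd⟩
    · exact ⟨(mem_sdiff.1 hyQ).1, hd⟩
  have hAsteep : ∀ y ∈ A, ⟪y - q, e⟫_ℝ ≤ -h := by
    intro y hy
    have hy' := hy
    rw [hA, mem_union, mem_filter, mem_filter] at hy'
    rcases hy' with ⟨hyP, hd⟩ | ⟨hyQ, hd, hΦ⟩
    · exact h2 y (hPX hyP) hd (Or.inl hyP)
    · exact h2 y (mem_sdiff.1 hyQ).1 hd (Or.inr ⟨hyQ, hΦ⟩)
  have hA3 : A.card ≤ 3 := by
    obtain ⟨hc, hu, hs⟩ := partners_unitVectors X hX q A hAX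
    rw [← hc]
    refine card_negCone_le_three_axis e he h hh0 hh58 hu (fun u hu' => ?_) hs
    obtain ⟨x, hx, rfl⟩ := mem_image.1 hu'
    exact hAsteep x hx
  -- the level partners are flat: at most six
  set L := (X \ P).filter fun x => dist q x = 1 ∧ Φ x = Φ q with hL
  have hL6 : L.card ≤ 6 := by
    obtain ⟨hc, hu, hs⟩ := partners_unitVectors X hX q L
      (fun x hx => ⟨(mem_sdiff.1 (mem_filter.1 hx).1).1, (mem_filter.1 hx).2.1⟩)
    rw [← hc]
    refine card_thin_band_le_six_axis e he hu (fun u hu' => ?_) hs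
    obtain ⟨x, hx, rfl⟩ := mem_image.1 hu'
    obtain ⟨hxQ, hd, hΦ⟩ := mem_filter.1 hx
    exact h1 x hxQ hd hΦ
  zify at hAcard hA3 hL6
  linarith

/-- **(T2) at an antipodal ball, with exempt partners above.**  `P ⊆ X`, `R ⊆ X \ P`, `q ∈ R`;
film partners of `q` outside `R` are strictly Φ-above; on partners in `R` the potential `Φ` is
ordered like the real function `f`; substrate partners have `f < f q`; `f` is midpoint-convex at
`q`; and every partner of `q` in `P ∪ R` is `q + w` or `q − w` for `w` in a set `W` of at most six
vectors.  Then `#below + #plug ≤ (12 − deg q) + #above` at `q`. -/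
theorem antipodal_noGainPotential_of_above (X P R : Finset (EuclideanSpace ℝ (Fin 3)))
    (hPX : P ⊆ X) (hR : R ⊆ X \ P)
    (q : EuclideanSpace ℝ (Fin 3)) (Φ : EuclideanSpace ℝ (Fin 3) → ℤ)
    (f : EuclideanSpace ℝ (Fin 3) → ℝ)
    (habove : ∀ x ∈ (X \ P) \ R, dist q x = 1 → Φ q < Φ x)
    (hlt : ∀ x ∈ R, dist q x = 1 → (Φ x < Φ q ↔ f x < f q))
    (heq : ∀ x ∈ R, dist q x = 1 → (Φ x = Φ q ↔ f x = f q))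
    (hplug : ∀ p ∈ P, dist q p = 1 → f p < f q)
    (hconv : ∀ w : EuclideanSpace ℝ (Fin 3), 2 * f q ≤ f (q + w) + f (q - w))
    (W : Finset (EuclideanSpace ℝ (Fin 3))) (hW : W.card ≤ 6)
    (hslot : ∀ x ∈ X, dist q x = 1 → x ∉ (X \ P) \ R → ∃ w ∈ W, x = q + w ∨ x = q - w) :
    (((X \ P).filter fun x => dist q x = 1 ∧ Φ x < Φ q).card : ℤ)
        + ((P.filter fun p => dist q p = 1).card : ℤ)
      ≤ (12 - ((X.filter fun x => dist q x = 1).card : ℤ))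
        + (((X \ P).filter fun x => dist q x = 1 ∧ Φ q < Φ x).card : ℤ) := by
  classical
  rw [noGainPotential_iff X P hPX Φ q]
  -- the below / level partners are in `R`, read through `f`
  have hbelow : ((X \ P).filter fun x => dist q x = 1 ∧ Φ x < Φ q) =
      R.filter fun x => dist q x = 1 ∧ f x < f q := by
    ext x
    simp only [mem_filter]
    constructor
    · rintro ⟨hx, hd, hΦ⟩
      have hxR : x ∈ R := by
        by_contra hxR
        exact absurd hΦ (not_lt.2 (habove x (mem_sdiff.2 ⟨hx, hxR⟩) hd).le)
      exact ⟨hxR, hd, (hlt x hxR hd).1 hΦ⟩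
    · rintro ⟨hxR, hd, hf⟩
      exact ⟨hR hxR, hd, (hlt x hxR hd).2 hf⟩
  have hlevel : ((X \ P).filter fun x => dist q x = 1 ∧ Φ x = Φ q) =
      R.filter fun x => dist q x = 1 ∧ f x = f q := by
    ext x
    simp only [mem_filter]
    constructor
    · rintro ⟨hx, hd, hΦ⟩
      have hxR : x ∈ R := by
        by_contra hxR
        exact absurd hΦ (habove x (mem_sdiff.2 ⟨hx, hxR⟩) hd).ne'
      exact ⟨hxR, hd, (heq x hxR hd).1 hΦ⟩
    · rintro ⟨hxR, hd, hf⟩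
      exact ⟨hR hxR, hd, (heq x hxR hd).2 hf⟩
  rw [hbelow, hlevel]
  -- the weight-two set `A` and the level set `L`
  set A := (P.filter fun p => dist q p = 1) ∪ (R.filter fun x => dist q x = 1 ∧ f x < f q) with hA
  set L := R.filter fun x => dist q x = 1 ∧ f x = f q with hL
  have hPR : Disjoint P R := (disjoint_sdiff (s := P) (t := X)).mono_right hR
  have hAcard : A.card = (P.filter fun p => dist q p = 1).card +
      (R.filter fun x => dist q x = 1 ∧ f x < f q).card := by
    rw [hA, card_union_of_disjoint]
    exact disjoint_filter_filter hPR
  have hAf : ∀ y ∈ A, (y ∈ X ∧ dist q y = 1 ∧ y ∉ (X \ P) \ R) ∧ f y < f q := by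
    intro y hy
    rw [hA, mem_union, mem_filter, mem_filter] at hy
    rcases hy with ⟨hyP, hd⟩ | ⟨hyR, hd, hf⟩
    · refine ⟨⟨hPX hyP, hd, fun h' => ?_⟩, hplug y hyP hd⟩
      exact (mem_sdiff.1 (mem_sdiff.1 h').1).2 hyP
    · refine ⟨⟨(mem_sdiff.1 (hR hyR)).1, hd, fun h' => (mem_sdiff.1 h').2 hyR⟩, hf⟩
  have hLf : ∀ y ∈ L, (y ∈ X ∧ dist q y = 1 ∧ y ∉ (X \ P) \ R) ∧ f y = f q := by
    intro y hy
    rw [hL, mem_filter] at hy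
    exact ⟨⟨(mem_sdiff.1 (hR hy.1)).1, hy.2.1, fun h' => (mem_sdiff.1 h').2 hy.1⟩, hy.2.2⟩
  -- the pair lemma
  have pair : ∀ w : EuclideanSpace ℝ (Fin 3), q + w ∈ A → q - w ∉ A ∧ q - w ∉ L := by
    intro w hw
    have h1 := (hAf _ hw).2
    have hc := hconv w
    constructor
    · intro h2; have := (hAf _ h2).2; linarith
    · intro h2; have := (hLf _ h2).2; linarith
  -- index sets on `W`
  set IA := W.filter fun w => q + w ∈ A with hIA
  set IA' := W.filter fun w => q - w ∈ A with hIA'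
  set IL := W.filter fun w => q + w ∈ L with hIL
  set IL' := W.filter fun w => q - w ∈ L with hIL'
  have cover : ∀ (S : Finset (EuclideanSpace ℝ (Fin 3))),
      (∀ y ∈ S, y ∈ X ∧ dist q y = 1 ∧ y ∉ (X \ P) \ R) →
      S.card ≤ (W.filter fun w => q + w ∈ S).card + (W.filter fun w => q - w ∈ S).card := by
    intro S hS
    have hsub : S ⊆ (W.filter fun w => q + w ∈ S).image (fun w => q + w) ∪
        (W.filter fun w => q - w ∈ S).image (fun w => q - w) := by
      intro y hy
      obtain ⟨w, hw, h⟩ := hslot y (hS y hy).1 (hS y hy).2.1 (hS y hy).2.2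
      rw [mem_union]
      rcases h with rfl | rfl
      · exact Or.inl (mem_image.2 ⟨w, mem_filter.2 ⟨hw, hy⟩, rfl⟩)
      · exact Or.inr (mem_image.2 ⟨w, mem_filter.2 ⟨hw, hy⟩, rfl⟩)
    calc S.card ≤ ((W.filter fun w => q + w ∈ S).image (fun w => q + w) ∪
          (W.filter fun w => q - w ∈ S).image (fun w => q - w)).card := card_le_card hsub
      _ ≤ ((W.filter fun w => q + w ∈ S).image (fun w => q + w)).card +
          ((W.filter fun w => q - w ∈ S).image (fun w => q - w)).card := card_union_le _ _
      _ ≤ (W.filter fun w => q + w ∈ S).card + (W.filter fun w => q - w ∈ S).card :=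
          add_le_add card_image_le card_image_le
  have hcardA : A.card ≤ IA.card + IA'.card := cover A fun y hy => (hAf y hy).1
  have hcardL : L.card ≤ IL.card + IL'.card := cover L fun y hy => (hLf y hy).1
  have hd1 : Disjoint IA IA' := by
    rw [hIA, hIA']
    exact disjoint_filter.2 fun w _ h1 h2 => (pair w h1).1 h2
  have hd2 : Disjoint IA (IL ∪ IL') := by
    rw [hIA, hIL, hIL', ← filter_or]
    refine disjoint_filter.2 fun w _ h1 h2 => ?_
    rcases h2 with h2 | h2
    · have := (hAf _ h1).2; have := (hLf _ h2).2; linarith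
    · exact (pair w h1).2 h2
  have hd3 : Disjoint IA' (IL ∪ IL') := by
    rw [hIA', hIL, hIL', ← filter_or]
    refine disjoint_filter.2 fun w _ h1 h2 => ?_
    rcases h2 with h2 | h2
    · have h := (pair (-w) (by rw [← sub_eq_add_neg]; exact h1)).2
      rw [sub_neg_eq_add] at h
      exact h h2
    · have := (hAf _ h1).2; have := (hLf _ h2).2; linarith
  have hunion : (IA ∪ IA' ∪ (IL ∪ IL')).card ≤ 6 := by
    refine le_trans (card_le_card ?_) hW
    rw [hIA, hIA', hIL, hIL']
    exact union_subset (union_subset (filter_subset _ _) (filter_subset _ _))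
      (union_subset (filter_subset _ _) (filter_subset _ _))
  rw [card_union_of_disjoint (disjoint_union_left.2 ⟨hd2, hd3⟩), card_union_of_disjoint hd1]
    at hunion
  have hLL : IL.card + IL'.card ≤ 2 * (IL ∪ IL').card := by
    have h1 : IL.card ≤ (IL ∪ IL').card := card_le_card subset_union_left
    have h2 : IL'.card ≤ (IL ∪ IL').card := card_le_card subset_union_right
    linarith
  zify at hAcard hcardA hcardL hunion hLL
  linarith

/-! ### The lexicographic potential -/

/-- Strict lexicographic comparison of `Z·M + r` with `0 ≤ r < M`. -/
theorem zoneLex_lt_iff (a b r s M : ℤ) (hr : 0 ≤ r) (hrM : r < M) (hs : 0 ≤ s) (hsM : s < M) :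
    a * M + r < b * M + s ↔ a < b ∨ (a = b ∧ r < s) := by
  constructor
  · intro h
    rcases lt_trichotomy a b with hab | hab | hab
    · exact Or.inl hab
    · exact Or.inr ⟨hab, by rw [hab] at h; linarith⟩
    · exfalso
      have : b + 1 ≤ a := hab
      nlinarith
  · rintro (hab | ⟨rfl, hrs⟩)
    · have : a + 1 ≤ b := hab
      nlinarith
    · linarith

/-- Lexicographic equality of `Z·M + r` with `0 ≤ r < M`. -/
theorem zoneLex_eq_iff (a b r s M : ℤ) (hr : 0 ≤ r) (hrM : r < M) (hs : 0 ≤ s) (hsM : s < M) :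
    a * M + r = b * M + s ↔ a = b ∧ r = s := by
  constructor
  · intro h
    rcases lt_trichotomy a b with hab | hab | hab
    · exfalso; have : a + 1 ≤ b := hab; nlinarith
    · exact ⟨hab, by rw [hab] at h; linarith⟩
    · exfalso; have : b + 1 ≤ a := hab; nlinarith
  · rintro ⟨rfl, rfl⟩; rfl

end Summit.Ventures.Crystal3D.Theorems

end
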